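import Literature.Analysis.UnboundedOperators.UnitaryGroupGenerator
import HarnessLib

/-!
# Generator of a strongly continuous group: two-sided difference quotients
(proofs layer over `StrongContRepresentation.lean`, item C3)

This file discharges the named fact
`Literature.Analysis.UnboundedOperators.OneParameterGroup.tendsto_generator_two_sided`
(`StrongContRepresentation.lean`): for a strongly continuous one-parameter group `U` on a Banach
space and `x ∈ D(A)`, where `A` is the generator of the forward semigroup `(U(t))_{t ≥ 0}`
(right-hand limit `t ↓ 0`, Engel–Nagel Ch. II Def. 1.2), the *two-sided* difference quotient
`t⁻¹ (U(t) x - x)` converges to `A x` as `t → 0`, `t ≠ 0`. This is the content of the remark in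
Engel–Nagel §II.3.11 (Generators of groups: the generator of a group, defined by the two-sided
limit, is the generator of its forward semigroup `T₊`; verbatim also in Engel–Nagel (2006),
§II.3.11), of Pazy (1983), §1.6 (paragraph after Def. 6.2), and of Applebaum (2019),
Prop. 4.3.10; we follow the printed proof of Applebaum (2019), Lemma 4.3.9 and Prop. 4.3.10
(after Pazy, pp. 23–24):

* `OneParameterGroup.tendsto_app_apply_of_tendsto` (Applebaum Lemma 4.3.9, group version): if
  `τᵢ → 0` and `g i → y` then `U(τᵢ) (g i) → y`, from the uniform bound `‖U(s)‖ ≤ C` on `[-1, 1]`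
  (Banach–Steinhaus, tree lemma `OneParameterGroup.exists_norm_app_le`, Engel–Nagel Prop. I.5.5)
  and strong continuity;
* `OneParameterGroup.inv_smul_app_sub_eq` : the algebraic identity
  `t⁻¹ (U(t) x - x) = U(t) ((-t)⁻¹ (U(-t) x - x))` (Applebaum, proof of Prop. 4.3.10, last display);
* `OneParameterGroup.tendsto_generator_two_sided_holds`: the left-hand limit `t ↑ 0` is obtained
  from the right-hand one by the identity and the lemma, and `𝓝[≠] 0 = 𝓝[<] 0 ⊔ 𝓝[>] 0`.

As a cheap corollary we also discharge the companion fact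
`OneParameterGroup.mem_generator_domain_iff_two_sided` (`x ∈ D(A)` iff the two-sided limit
exists): `OneParameterGroup.mem_generator_domain_iff_two_sided_holds`.

Sources: K.-J. Engel, R. Nagel, *One-Parameter Semigroups for Linear Evolution Equations*
(Springer GTM 194, 2000), §II.3.11; K.-J. Engel, R. Nagel, *A Short Course on Operator Semigroups*
(Universitext, 2006), §II.3.11; A. Pazy, *Semigroups of Linear Operators and Applications to
Partial Differential Equations* (Springer, 1983), §1.6, Def. 6.2 and Lemma 6.4; D. Applebaum,
*Semigroups of Linear Operators* (CUP, 2019), Lemma 4.3.9, Prop. 4.3.10.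
-/

noncomputable section

open Filter Topology NNReal

namespace Literature.Analysis.UnboundedOperators

namespace OneParameterGroup

variable {𝕜 E : Type*} [RCLike 𝕜] [NormedAddCommGroup E] [NormedSpace 𝕜 E]

/-- **Applebaum (2019), Lemma 4.3.9 (group version).** For a strongly continuous group `U` on a
Banach space: if `τ i → 0` and `g i → y` along a filter `l`, then `U(τ i) (g i) → y` along `l`.
Proof as printed: `‖U(τ) g - y‖ ≤ ‖U(τ)‖ ‖g - y‖ + ‖U(τ) y - y‖` with `‖U(τ)‖ ≤ C` for
`τ ∈ [-1, 1]` (uniform boundedness, Engel–Nagel (2000), Ch. I Prop. 5.5) and strong continuity.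
[cite: Applebaum2019, Lemma 4.3.9] -/
theorem tendsto_app_apply_of_tendsto [CompleteSpace E] (U : OneParameterGroup 𝕜 E) {ι : Type*}
    {l : Filter ι} {τ : ι → ℝ} (hτ : Tendsto τ l (𝓝 0)) {g : ι → E} {y : E}
    (hg : Tendsto g l (𝓝 y)) : Tendsto (fun i => U.app (τ i) (g i)) l (𝓝 y) := by
  obtain ⟨C, hC⟩ := U.exists_norm_app_le (-1) 1
  have hmem : ∀ᶠ i in l, τ i ∈ Set.Icc (-1 : ℝ) 1 :=
    hτ (Icc_mem_nhds (by norm_num) (by norm_num))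
  rw [tendsto_iff_norm_sub_tendsto_zero] at hg ⊢
  have h2 : Tendsto (fun i => ‖U.app (τ i) y - y‖) l (𝓝 0) := by
    have hc : Continuous fun t : ℝ => ‖U.app t y - y‖ := by fun_prop
    have h0 : ‖U.app 0 y - y‖ = 0 := by simp
    have := (hc.tendsto 0).comp hτ
    rw [h0] at this
    exact this
  refine squeeze_zero_norm' ?_ (by simpa using (hg.const_mul C).add h2)
  filter_upwards [hmem] with i hi
  rw [Real.norm_of_nonneg (norm_nonneg _)]
  calc ‖U.app (τ i) (g i) - y‖
      = ‖U.app (τ i) (g i - y) + (U.app (τ i) y - y)‖ := by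
        congr 1; simp only [map_sub]; abel
    _ ≤ ‖U.app (τ i) (g i - y)‖ + ‖U.app (τ i) y - y‖ := norm_add_le _ _
    _ ≤ ‖U.app (τ i)‖ * ‖g i - y‖ + ‖U.app (τ i) y - y‖ := by
        gcongr; exact (U.app (τ i)).le_opNorm _
    _ ≤ C * ‖g i - y‖ + ‖U.app (τ i) y - y‖ := by
        gcongr; exact hC _ hi

/-- The algebraic identity behind the left-hand difference quotient of a group:
`t⁻¹ (U(t) x - x) = U(t) ((-t)⁻¹ (U(-t) x - x))` (Applebaum (2019), proof of Prop. 4.3.10, last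
display; Pazy (1983), proof of Lemma 1.6.4). [cite: Applebaum2019, Prop. 4.3.10] -/
theorem inv_smul_app_sub_eq (U : OneParameterGroup 𝕜 E) (t : ℝ) (x : E) :
    ((t⁻¹ : ℝ) : 𝕜) • (U.app t x - x) = U.app t ((((-t)⁻¹ : ℝ) : 𝕜) • (U.app (-t) x - x)) := by
  have h : U.app t (U.app (-t) x) = x := by
    simpa only [neg_neg] using U.app_neg_apply_app (-t) x
  rw [map_smul, map_sub, h, inv_neg, RCLike.ofReal_neg, neg_smul, ← smul_neg, neg_sub]

/-- **Discharge of `tendsto_generator_two_sided`** (Engel–Nagel (2000), §II.3.11, Generators of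
groups: the generator of the forward semigroup of a strongly continuous group is its two-sided
generator; Pazy (1983), §1.6 after Def. 6.2; Applebaum (2019), Prop. 4.3.10). For `x ∈ D(A)` the
right-hand quotient converges to `A x` by definition (`C0Semigroup.tendsto_generator`); the
left-hand one is `U(t) ((-t)⁻¹ (U(-t) x - x))` with `-t ↓ 0`, which converges to `A x` by
`tendsto_app_apply_of_tendsto`. [cite: EngelNagel2000, §II.3.11] -/
theorem tendsto_generator_two_sided_holds : tendsto_generator_two_sided (𝕜 := 𝕜) (E := E) := by
  intro _ U x
  have hright : Tendsto (fun t : ℝ => ((t⁻¹ : ℝ) : 𝕜) • (U.app t (x : E) - x)) (𝓝[>] 0)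
      (𝓝 (U.generator x)) := by
    refine (C0Semigroup.tendsto_generator U.toC0Semigroup x).congr' ?_
    filter_upwards [self_mem_nhdsWithin] with t (ht : 0 < t)
    rw [toC0Semigroup_app, Real.coe_toNNReal _ ht.le]
  have hleft : Tendsto (fun t : ℝ => ((t⁻¹ : ℝ) : 𝕜) • (U.app t (x : E) - x)) (𝓝[<] 0)
      (𝓝 (U.generator x)) := by
    have hneg : Tendsto (fun t : ℝ => -t) (𝓝[<] (0 : ℝ)) (𝓝[>] 0) := by
      simpa using (tendsto_neg_nhdsLT (a := (0 : ℝ)))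
    have hid : Tendsto (fun t : ℝ => t) (𝓝[<] (0 : ℝ)) (𝓝 0) :=
      tendsto_id'.2 nhdsWithin_le_nhds
    refine (U.tendsto_app_apply_of_tendsto hid (hright.comp hneg)).congr fun t => ?_
    exact (U.inv_smul_app_sub_eq t x).symm
  rw [← nhdsLT_sup_nhdsGT]
  exact hleft.sup hright

/-- **Discharge of `mem_generator_domain_iff_two_sided`** (Engel–Nagel (2000), §II.3.11; Pazy
(1983), §1.6, Def. 6.2 and the following paragraph): `x ∈ D(A)` iff the two-sided difference
quotient converges. (`→`) is `tendsto_generator_two_sided_holds`; (`←`) restricts the two-sided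
limit to `t ↓ 0`. [cite: EngelNagel2000, §II.3.11] -/
theorem mem_generator_domain_iff_two_sided_holds :
    mem_generator_domain_iff_two_sided (𝕜 := 𝕜) (E := E) := by
  intro _ U x
  constructor
  · intro hx
    exact ⟨U.generator ⟨x, hx⟩, tendsto_generator_two_sided_holds U ⟨x, hx⟩⟩
  · rintro ⟨y, hy⟩
    rw [generator_eq, C0Semigroup.mem_generator_domain_iff]
    refine ⟨y, ?_⟩
    have hy' := hy.mono_left (nhdsWithin_mono _
      (show Set.Ioi (0 : ℝ) ⊆ {0}ᶜ from fun t ht => ne_of_gt ht))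
    refine hy'.congr' ?_
    filter_upwards [self_mem_nhdsWithin] with t (ht : 0 < t)
    rw [toC0Semigroup_app, Real.coe_toNNReal _ ht.le]

end OneParameterGroup

end Literature.Analysis.UnboundedOperators
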